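import Mathlib
import Literature.NumberTheory.LFunctions.Zhang2022.Section13MeanSquareB
import Literature.NumberTheory.LFunctions.Zhang2022.Section13U007b
import HarnessLib

/-!
# Zhang (2022) §13, towards (13.11): the `Ψ`-mean squares of the products `N(s+β_j,ψ)·B_i(s,ψ)`
# on the strip `|σ − ½| ≤ 2α` (item I3-N of the WP14 plan), kernel-checked

Topic `Literature/NumberTheory/LFunctions/Zhang2022` (Landau–Siegel audit tree; verdict-neutral).
Y. Zhang, *Discrete mean estimates and the Landau–Siegel zero*, arXiv:2211.02515v1 (2022)
[Zhang2022LandauSiegel] — **an unrefereed manuscript under adjudication**; this THEOREM-ONLY file proves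
large-sieve mean-square bounds for objects of the manuscript and asserts nothing about its Theorems 1–2,
about (13.11) itself, or about Landau–Siegel zeros.

§13 p. 75 (tex L3806–L3817): the terms of `𝔈` (display after (13.10)) carrying `‖N(ρ+β_j,ψ)‖` — the
`𝓛⁻¹²³|N(ρ+β₃)|`-, `𝓛⁻¹²³|N(ρ+β₂)|`- and `E₁`-terms of `E₁*(ρ,ψ)` ((13.3), from Lemma 6.1) times
`|B(ρ,ψ)|` — are, after the (2.34)-conversion to the segments `𝒥(±α)` and Cauchy's inequality
("Combining (2.34), Cauchy's inequality, … Lemma 6.1 and 3.3"), controlled by mean squares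
`Σ_ψ |N(s+β_j,ψ)F(s,ψ)|²` with `F` one of the two factors `B₁ = H₁₄ + ι₂H₁₂`, `B₂ = H₂` of
`B = B₁B₂` (12.2) (or `B` itself). Since `N(w,ψ) = Σ_{n<2T²} ψ(n)n^{−w}g*(T²/n)` (Lemma 6.1) and
`F(s,ψ) = Σ a(n)ψχ(n)n^{−s}` are both `ψ`-twisted Dirichlet polynomials in the same `s` (the shift
`β_j` is purely imaginary and rides in the coefficient `n^{−β_j}`, `|n^{−β_j}| = 1`), the product is ONE
`ψ`-twisted polynomial of length `< 2T²·PT⁻² ≤ P²` whose coefficients are a Dirichlet convolution with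
a divisor-function majorant; Lemma 3.3 (ii) (`Skeleton.lemma33b_sum_le`) then applies verbatim:

* `mul_twisted_eq_sum_fiber` — `(Σ_{m<L} F(m)ψ(m)m^{−s})(Σ_{n<M} G(n)ψ(n)n^{−s}) = Σ_{k≤K} c(k)ψ(k)k^{−s}`
  with `c(k) = Σ_{mn=k, m<L, n<M} F(m)G(n)` whenever `(L−1)(M−1) ≤ K` (exact regrouping);
* `norm_fiberSum_le` — `|c(k)| ≤ K_F K_G τ_{j₁+j₂}(k)` from `|F| ≤ K_Fτ_{j₁}`, `|G| ≤ K_Gτ_{j₂}`;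
* `meanSq_mul_le_of_le_tau` (+ conjugate-twist twin `meanSq_mulConj_le_of_le_tau`) — on
  `|σ − ½| ≤ 2α`: `Σ_{ψ∈T} |(Σ F ψ m^{−s})(Σ G ψ n^{−s})|² ≤ C₃₃e^{8π}·majorantConst·(K_FK_G)²·P²·(3𝓛⁹)^{(j₁+j₂)²}`;
* `Nchar_shift_eq_sum` — `N(s+β,ψ) = Σ_{m<2T²} [m^{−β}g*(T²/m)]·ψ(m)m^{−s}`, coefficient of modulus `≤ 1`
  for `Re β = 0`;
* instances (for `𝓛 ≥ 3`, `Re β = 0`, `|σ − ½| ≤ 2α`, any finite `T ⊆ Ψ`): `meanSq_Nchar_mul_B1_le` —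
  `Σ_{ψ∈T} |N(s+β,ψ)(H₁₄ + ι₂H₁₂)(s,ψ)|² ≤ C·P²·𝓛³⁶`; `meanSq_Nchar_mul_H2_le` — the same for `H₂`;
  `meanSq_Nchar_mul_Bpoly_le` — `Σ_{ψ∈T} |N(s+β,ψ)B(s,ψ)|² ≤ C·P²·𝓛⁸¹`, explicit absolute constants.

ZHANG-L WP14 item I3-N (helper of the (13.11)ᴿ programme under the leaf `Skeleton.Eq1311Rel`).

## References

* Y. Zhang, arXiv:2211.02515v1 (2022), §13 (13.3), (13.11) p. 75, §6 Lemma 6.1 p. 30, §12 (12.2),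
  Lemma 3.3 p. 14. [cite: Zhang2022LandauSiegel, §13 (13.11) p.75]
-/

noncomputable section

open Complex Real ComplexConjugate

namespace Literature.NumberTheory.LFunctions.Zhang2022.Typed.Section13

open Skeleton MeanSquareMajorant

/-! ## Products of two `ψ`-twisted Dirichlet polynomials -/

section Products

variable {D : ℕ} (x : Chr D)

omit x in
/-- `|c(k)| ≤ Σ_{mn=k} |F(m)||G(n)| ≤ K_F·K_G·τ_{j₁+j₂}(k)` for `k ≥ 1`, if `|F(m)| ≤ K_Fτ_{j₁}(m)` and
`|G(n)| ≤ K_Gτ_{j₂}(n)` (`m, n ≥ 1`, `K_F ≥ 0`). [cite: Zhang2022LandauSiegel, §13 p.75; §15 (15.2)] -/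
theorem norm_fiberSum_le {F G : ℕ → ℂ} {KF KG : ℝ} {j₁ j₂ : ℕ} (hKF : 0 ≤ KF)
    (hF : ∀ m, m ≠ 0 → ‖F m‖ ≤ KF * tau j₁ m) (hG : ∀ n, n ≠ 0 → ‖G n‖ ≤ KG * tau j₂ n)
    (L M : ℕ) {k : ℕ} (hk : k ≠ 0) :
    ‖(∑ q ∈ (Finset.Ico 1 L ×ˢ Finset.Ico 1 M).filter (fun q => q.1 * q.2 = k), F q.1 * G q.2)‖ ≤
      KF * KG * tau (j₁ + j₂) k := by
  have hsub : (Finset.Ico 1 L ×ˢ Finset.Ico 1 M).filter (fun q => q.1 * q.2 = k) ⊆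
      k.divisorsAntidiagonal := by
    intro q hq
    rw [Finset.mem_filter] at hq
    exact Nat.mem_divisorsAntidiagonal.mpr ⟨hq.2, hk⟩
  calc ‖∑ q ∈ (Finset.Ico 1 L ×ˢ Finset.Ico 1 M).filter (fun q => q.1 * q.2 = k), F q.1 * G q.2‖
      ≤ ∑ q ∈ (Finset.Ico 1 L ×ˢ Finset.Ico 1 M).filter (fun q => q.1 * q.2 = k), ‖F q.1 * G q.2‖ :=
        norm_sum_le _ _
    _ ≤ ∑ q ∈ k.divisorsAntidiagonal, ‖F q.1 * G q.2‖ :=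
        Finset.sum_le_sum_of_subset_of_nonneg hsub fun q _ _ => norm_nonneg _
    _ ≤ ∑ q ∈ k.divisorsAntidiagonal, KF * KG * (tau j₁ q.1 * tau j₂ q.2) := by
        refine Finset.sum_le_sum fun q hq => ?_
        have hq' := Nat.mem_divisorsAntidiagonal.mp hq
        have h1 : q.1 ≠ 0 := by intro h; apply hq'.2; rw [← hq'.1, h, zero_mul]
        have h2 : q.2 ≠ 0 := by intro h; apply hq'.2; rw [← hq'.1, h, mul_zero]
        rw [norm_mul]
        calc ‖F q.1‖ * ‖G q.2‖ ≤ (KF * tau j₁ q.1) * (KG * tau j₂ q.2) :=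
              mul_le_mul (hF _ h1) (hG _ h2) (norm_nonneg _) (mul_nonneg hKF (tau_nonneg _ _))
          _ = KF * KG * (tau j₁ q.1 * tau j₂ q.2) := by ring
    _ = KF * KG * tau (j₁ + j₂) k := by rw [← Finset.mul_sum, tau_add_apply]

/-- **The product of two `ψ`-twisted Dirichlet polynomials is one `ψ`-twisted polynomial** with the
convolved coefficients, regrouped along `k = mn` (`ψ(m)ψ(n) = ψ(mn)`, `(mn)^{−s} = m^{−s}n^{−s}`):
`(Σ_{1≤m<L} F(m)ψ(m)m^{−s})(Σ_{1≤n<M} G(n)ψ(n)n^{−s}) = Σ_{1≤k≤K} c(k)ψ(k)k^{−s}` whenever every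
product `mn` (`m < L`, `n < M`) is `≤ K`. [cite: Zhang2022LandauSiegel, §13 p.75; §16 p.33] -/
theorem mul_twisted_eq_sum_fiber (F G : ℕ → ℂ) {L M K : ℕ} (hK : (L - 1) * (M - 1) ≤ K) (s : ℂ) :
    (∑ m ∈ Finset.Ico 1 L, F m * x.ψ (m : ZMod x.p) * (m : ℂ) ^ (-s)) *
        (∑ n ∈ Finset.Ico 1 M, G n * x.ψ (n : ZMod x.p) * (n : ℂ) ^ (-s)) =
      ∑ k ∈ Finset.Icc 1 K,
        (∑ q ∈ (Finset.Ico 1 L ×ˢ Finset.Ico 1 M).filter (fun q => q.1 * q.2 = k), F q.1 * G q.2) *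
          x.ψ (k : ZMod x.p) * (k : ℂ) ^ (-s) := by
  rw [Finset.sum_mul_sum, ← Finset.sum_product']
  -- regroup the double sum along the fibres of `(m,n) ↦ mn`
  have hmaps : ∀ q ∈ Finset.Ico 1 L ×ˢ Finset.Ico 1 M, q.1 * q.2 ∈ Finset.Icc 1 K := by
    intro q hq
    rw [Finset.mem_product, Finset.mem_Ico, Finset.mem_Ico] at hq
    rw [Finset.mem_Icc]
    refine ⟨Nat.one_le_iff_ne_zero.mpr (Nat.mul_ne_zero (by omega) (by omega)), ?_⟩
    calc q.1 * q.2 ≤ (L - 1) * (M - 1) := Nat.mul_le_mul (by omega) (by omega)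
      _ ≤ K := hK
  rw [← Finset.sum_fiberwise_of_maps_to hmaps]
  refine Finset.sum_congr rfl fun k _ => ?_
  rw [Finset.sum_mul, Finset.sum_mul]
  refine Finset.sum_congr rfl fun q hq => ?_
  rw [Finset.mem_filter] at hq
  have hk : ((q.1 : ℂ) * (q.2 : ℂ)) = (k : ℂ) := by rw [← hq.2]; push_cast; ring
  have hψ : x.ψ (q.1 : ZMod x.p) * x.ψ (q.2 : ZMod x.p) = x.ψ (k : ZMod x.p) := by
    rw [← map_mul, ← hq.2]; push_cast; ring_nf
  have hpow : ((q.1 : ℕ) : ℂ) ^ (-s) * ((q.2 : ℕ) : ℂ) ^ (-s) = (k : ℂ) ^ (-s) := by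
    rw [← Complex.natCast_mul_natCast_cpow, hk]
  calc F q.1 * x.ψ (q.1 : ZMod x.p) * (q.1 : ℂ) ^ (-s) * (G q.2 * x.ψ (q.2 : ZMod x.p) * (q.2 : ℂ) ^ (-s))
      = F q.1 * G q.2 * (x.ψ (q.1 : ZMod x.p) * x.ψ (q.2 : ZMod x.p)) *
          (((q.1 : ℕ) : ℂ) ^ (-s) * ((q.2 : ℕ) : ℂ) ^ (-s)) := by ring
    _ = F q.1 * G q.2 * x.ψ (k : ZMod x.p) * (k : ℂ) ^ (-s) := by rw [hψ, hpow]

/-- For natural-number bases: `conj((n:ℂ)^w) = (n:ℂ)^(conj w)`. [folklore] -/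
private theorem conj_natCast_cpow' (n : ℕ) (w : ℂ) : conj ((n : ℂ) ^ w) = (n : ℂ) ^ (conj w) := by
  have harg : ((n : ℂ)).arg ≠ π := by
    rw [show (n : ℂ) = ((n : ℝ) : ℂ) by norm_cast, Complex.arg_ofReal_of_nonneg (Nat.cast_nonneg n)]
    exact Real.pi_ne_zero.symm
  rw [Complex.cpow_conj _ _ harg]
  simp

/-- The conjugate-twisted polynomial is the conjugate of the `ψ`-twisted one with conjugate
coefficients at `s̄`. [folklore] -/
private theorem sum_conjTwist_eq (F : ℕ → ℂ) (L : ℕ) (s : ℂ) :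
    ∑ m ∈ Finset.Ico 1 L, F m * conj (x.ψ (m : ZMod x.p)) * (m : ℂ) ^ (-s) =
      conj (∑ m ∈ Finset.Ico 1 L, conj (F m) * x.ψ (m : ZMod x.p) * (m : ℂ) ^ (-conj s)) := by
  rw [map_sum]
  refine Finset.sum_congr rfl fun m _ => ?_
  rw [map_mul, map_mul, Complex.conj_conj, conj_natCast_cpow', map_neg, Complex.conj_conj]

/-- **Mean square of a product of two `ψ`-twisted polynomials over `Ψ`, on the strip `|σ − ½| ≤ 2α`**:
if `|F(m)| ≤ K_Fτ_{j₁}(m)`, `|G(n)| ≤ K_Gτ_{j₂}(n)` (`m, n ≥ 1`, `K_F ≥ 0`), `𝓛 ≥ 1` and the lengths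
satisfy `(L−1)(M−1) ≤ ⌊P²⌋`, then for any finite `T ⊆ Ψ`,
`Σ_{ψ∈T} |(Σ_{m<L} F ψ m^{−s})(Σ_{n<M} G ψ n^{−s})|²
  ≤ C₃₃·e^{8π}·majorantConst((j₁+j₂)²,2(j₁+j₂))·(K_FK_G)²·P²·(log(⌊P²⌋+1))^{(j₁+j₂)²}`
(Lemma 3.3 (ii) `Skeleton.lemma33b_sum_le` on the regrouped polynomial; `n^{−2σ} ≤ e^{8π}/n` on the
strip; `Σ_{k≤X} τ_j(k)²/k ≤ majorantConst·(log X)^{j²}`).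
[cite: Zhang2022LandauSiegel, §13 (13.11) p.75; Lemma 3.3 p.14] -/
theorem meanSq_mul_le_of_le_tau (hL : 1 ≤ ell D) (T : Finset (Chr D)) {s : ℂ}
    (hs : |s.re - 1 / 2| ≤ 2 * alpha D) {F G : ℕ → ℂ} {KF KG : ℝ} {j₁ j₂ : ℕ} (hKF : 0 ≤ KF)
    (hF : ∀ m, m ≠ 0 → ‖F m‖ ≤ KF * tau j₁ m) (hG : ∀ n, n ≠ 0 → ‖G n‖ ≤ KG * tau j₂ n)
    {L M : ℕ} (hLM : (L - 1) * (M - 1) ≤ ⌊bigP D ^ 2⌋₊) :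
    ∑ x ∈ T, ‖(∑ m ∈ Finset.Ico 1 L, F m * x.ψ (m : ZMod x.p) * (m : ℂ) ^ (-s)) *
        (∑ n ∈ Finset.Ico 1 M, G n * x.ψ (n : ZMod x.p) * (n : ℂ) ^ (-s))‖ ^ 2 ≤
      (2 + 2 * (3 + (Real.log 2 ^ 68)⁻¹) ^ 2) * Real.exp (8 * π) *
        majorantConst ((j₁ + j₂) ^ 2) (2 * (j₁ + j₂)) * (KF * KG) ^ 2 * bigP D ^ 2 *
          Real.log ((⌊bigP D ^ 2⌋₊ + 1 : ℕ) : ℝ) ^ ((j₁ + j₂) ^ 2) := by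
  simp_rw [mul_twisted_eq_sum_fiber _ F G hLM]
  have h1 := lemma33b_sum_le T s
    (fun k => (∑ q ∈ (Finset.Ico 1 L ×ˢ Finset.Ico 1 M).filter (fun q => q.1 * q.2 = k), F q.1 * G q.2))
  refine h1.trans ?_
  -- the coefficient sum
  have hP2 : 1 ≤ ⌊bigP D ^ 2⌋₊ + 1 := by omega
  have hIcc : Finset.Icc 1 ⌊bigP D ^ 2⌋₊ = Finset.Ico 1 (⌊bigP D ^ 2⌋₊ + 1) := by
    ext k; simp only [Finset.mem_Icc, Finset.mem_Ico]; omega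
  have h2 : ∑ k ∈ Finset.Icc 1 ⌊bigP D ^ 2⌋₊,
      ‖(∑ q ∈ (Finset.Ico 1 L ×ˢ Finset.Ico 1 M).filter (fun q => q.1 * q.2 = k), F q.1 * G q.2)‖ ^ 2 * (k : ℝ) ^ (-2 * s.re) ≤
      ∑ k ∈ Finset.Ico 1 (⌊bigP D ^ 2⌋₊ + 1), (KF * KG * tau (j₁ + j₂) k) ^ 2 * (k : ℝ) ^ (-2 * s.re) := by
    rw [hIcc]
    refine Finset.sum_le_sum fun k hk => ?_
    rw [Finset.mem_Ico] at hk
    have h0 : 0 ≤ (k : ℝ) ^ (-2 * s.re) := Real.rpow_nonneg (Nat.cast_nonneg k) _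
    exact mul_le_mul_of_nonneg_right (pow_le_pow_left₀ (norm_nonneg _)
      (norm_fiberSum_le hKF hF hG L M (by omega)) 2) h0
  have hN2 : 2 ≤ ⌊bigP D ^ 2⌋₊ + 1 := by
    have hP1 : (1 : ℝ) ≤ bigP D ^ 2 := one_le_pow₀ (by rw [bigP]; exact Real.one_le_exp (by positivity))
    have : 1 ≤ ⌊bigP D ^ 2⌋₊ := Nat.le_floor (by exact_mod_cast hP1)
    omega
  have h3 := sum_tau_sq_rpow_le hL hs hN2 le_rfl (KF * KG) (j₁ + j₂)
  have hC0 : 0 ≤ (2 + 2 * (3 + (Real.log 2 ^ 68)⁻¹) ^ 2) * bigP D ^ 2 :=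
    mul_nonneg c33_nonneg (by positivity)
  calc (2 + 2 * (3 + (Real.log 2 ^ 68)⁻¹) ^ 2) * bigP D ^ 2 *
        ∑ k ∈ Finset.Icc 1 ⌊bigP D ^ 2⌋₊,
          ‖(∑ q ∈ (Finset.Ico 1 L ×ˢ Finset.Ico 1 M).filter (fun q => q.1 * q.2 = k), F q.1 * G q.2)‖ ^ 2 * (k : ℝ) ^ (-2 * s.re)
      ≤ (2 + 2 * (3 + (Real.log 2 ^ 68)⁻¹) ^ 2) * bigP D ^ 2 *
          (Real.exp (8 * π) * majorantConst ((j₁ + j₂) ^ 2) (2 * (j₁ + j₂)) * (KF * KG) ^ 2 *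
            Real.log ((⌊bigP D ^ 2⌋₊ + 1 : ℕ) : ℝ) ^ ((j₁ + j₂) ^ 2)) :=
        mul_le_mul_of_nonneg_left (h2.trans h3) hC0
    _ = _ := by ring

/-- **Conjugate-twist twin** of `meanSq_mul_le_of_le_tau` (the reflected factors `F̄(1−s)` of the
(2.34)-conversion are `ψ̄`-twisted): the same bound for
`Σ_{ψ∈T} |(Σ_{m<L} F ψ̄ m^{−s})(Σ_{n<M} G ψ̄ n^{−s})|²`.
[cite: Zhang2022LandauSiegel, §13 (13.11) p.75; Lemma 3.3 p.14] -/
theorem meanSq_mulConj_le_of_le_tau (hL : 1 ≤ ell D) (T : Finset (Chr D)) {s : ℂ}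
    (hs : |s.re - 1 / 2| ≤ 2 * alpha D) {F G : ℕ → ℂ} {KF KG : ℝ} {j₁ j₂ : ℕ} (hKF : 0 ≤ KF)
    (hF : ∀ m, m ≠ 0 → ‖F m‖ ≤ KF * tau j₁ m) (hG : ∀ n, n ≠ 0 → ‖G n‖ ≤ KG * tau j₂ n)
    {L M : ℕ} (hLM : (L - 1) * (M - 1) ≤ ⌊bigP D ^ 2⌋₊) :
    ∑ x ∈ T, ‖(∑ m ∈ Finset.Ico 1 L, F m * conj (x.ψ (m : ZMod x.p)) * (m : ℂ) ^ (-s)) *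
        (∑ n ∈ Finset.Ico 1 M, G n * conj (x.ψ (n : ZMod x.p)) * (n : ℂ) ^ (-s))‖ ^ 2 ≤
      (2 + 2 * (3 + (Real.log 2 ^ 68)⁻¹) ^ 2) * Real.exp (8 * π) *
        majorantConst ((j₁ + j₂) ^ 2) (2 * (j₁ + j₂)) * (KF * KG) ^ 2 * bigP D ^ 2 *
          Real.log ((⌊bigP D ^ 2⌋₊ + 1 : ℕ) : ℝ) ^ ((j₁ + j₂) ^ 2) := by
  have hkey : ∀ x : Chr D,
      ‖(∑ m ∈ Finset.Ico 1 L, F m * conj (x.ψ (m : ZMod x.p)) * (m : ℂ) ^ (-s)) *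
          (∑ n ∈ Finset.Ico 1 M, G n * conj (x.ψ (n : ZMod x.p)) * (n : ℂ) ^ (-s))‖ =
        ‖(∑ m ∈ Finset.Ico 1 L, conj (F m) * x.ψ (m : ZMod x.p) * (m : ℂ) ^ (-conj s)) *
          (∑ n ∈ Finset.Ico 1 M, conj (G n) * x.ψ (n : ZMod x.p) * (n : ℂ) ^ (-conj s))‖ := by
    intro x
    rw [sum_conjTwist_eq x F L s, sum_conjTwist_eq x G M s, ← map_mul, Complex.norm_conj]
  simp_rw [hkey]
  have hF' : ∀ m, m ≠ 0 → ‖conj (F m)‖ ≤ KF * tau j₁ m := fun m hm => by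
    rw [Complex.norm_conj]; exact hF m hm
  have hG' : ∀ n, n ≠ 0 → ‖conj (G n)‖ ≤ KG * tau j₂ n := fun n hn => by
    rw [Complex.norm_conj]; exact hG n hn
  have hs' : |(conj s).re - 1 / 2| ≤ 2 * alpha D := by rwa [Complex.conj_re]
  exact meanSq_mul_le_of_le_tau hL T hs' hKF hF' hG' hLM

end Products

/-! ## `N(s+β,ψ)` as a `ψ`-twisted polynomial, and the three instances -/

section Instances

variable {D : ℕ} (χ : DirichletCharacter ℂ D) (x : Chr D)

/-- **`N(s+β,ψ) = Σ_{1≤m<⌈2T²⌉} [m^{−β}g*(T²/m)]·ψ(m)·m^{−s}`** (Lemma 6.1's `N`, the shift carried by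
the coefficient). [cite: Zhang2022LandauSiegel, §6 Lemma 6.1 p.30; §13 (13.3) p.75] -/
theorem Nchar_shift_eq_sum (s β : ℂ) :
    Nchar D (psiFn x) (s + β) =
      ∑ m ∈ Finset.Ico 1 ⌈2 * bigT D ^ 2⌉₊,
        ((m : ℂ) ^ (-β) * (gstar D (bigT D ^ 2 / m) : ℂ)) * x.ψ (m : ZMod x.p) * (m : ℂ) ^ (-s) := by
  unfold Nchar psiFn
  refine Finset.sum_congr rfl fun m hm => ?_
  rw [Finset.mem_Ico] at hm
  have hm0 : (m : ℂ) ≠ 0 := by exact_mod_cast (show m ≠ 0 by omega)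
  rw [neg_add, Complex.cpow_add _ _ hm0]
  ring

omit χ x in
/-- The coefficient of `N(s+β,ψ)` has modulus `≤ 1` when `Re β = 0` (`|m^{−β}| = 1`, `0 ≤ g* < 1`).
[cite: Zhang2022LandauSiegel, §6 Lemma 6.1 p.30; §4 (4.1)] -/
theorem norm_Nchar_coeff_le (hL : 0 < ell D) {β : ℂ} (hβ : β.re = 0) (m : ℕ) (hm : m ≠ 0) :
    ‖(m : ℂ) ^ (-β) * (gstar D (bigT D ^ 2 / m) : ℂ)‖ ≤ 1 * tau 1 m := by
  rw [tau_one_apply hm, mul_one, norm_mul]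
  have h1 : ‖(m : ℂ) ^ (-β)‖ = 1 := by
    rw [Complex.norm_natCast_cpow_of_pos (Nat.pos_of_ne_zero hm), Complex.neg_re, hβ, neg_zero,
      Real.rpow_zero]
  rw [h1, one_mul]
  exact norm_gstar_le_one hL _

omit χ x in
/-- For `𝓛 ≥ 3`: `2T² ≤ P` (`P/T² = exp(𝓛⁹ − 2𝓛^{1.1}) ≥ e² ≥ 2`).
[cite: Zhang2022LandauSiegel, §2 (2.6); §6 Lemma 6.1] -/
theorem two_mul_bigT_sq_le_bigP (hL : 3 ≤ ell D) : 2 * bigT D ^ 2 ≤ bigP D := by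
  have hL1 : 1 ≤ ell D := by linarith
  have hL0 : 0 < ell D := by linarith
  have h11 : ell D ^ (1.1 : ℝ) ≤ ell D ^ 2 := by
    calc ell D ^ (1.1 : ℝ) ≤ ell D ^ ((2 : ℕ) : ℝ) :=
          Real.rpow_le_rpow_of_exponent_le hL1 (by norm_num)
      _ = ell D ^ 2 := Real.rpow_natCast _ 2
  have h9 : 2 * ell D ^ 2 + 2 ≤ ell D ^ 9 := by
    have h3 : (3 : ℝ) ^ 7 ≤ ell D ^ 7 := pow_le_pow_left₀ (by norm_num) hL 7
    have e : ell D ^ 9 = ell D ^ 7 * ell D ^ 2 := by ring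
    nlinarith [pow_nonneg hL0.le 2, pow_nonneg hL0.le 7]
  have hT2 : bigT D ^ 2 = Real.exp (2 * ell D ^ (1.1 : ℝ)) := by
    rw [bigT, ← Real.exp_nat_mul]; norm_num
  have hT0 : 0 < bigT D ^ 2 := by rw [hT2]; exact Real.exp_pos _
  have hPT : bigP D / bigT D ^ 2 = Real.exp (ell D ^ 9 - 2 * ell D ^ (1.1 : ℝ)) := by
    rw [bigP, hT2, ← Real.exp_sub]
  have hPT2 : 2 ≤ bigP D / bigT D ^ 2 := by
    rw [hPT]
    calc (2 : ℝ) ≤ 2 + 1 := by norm_num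
      _ ≤ Real.exp 2 := Real.add_one_le_exp 2
      _ ≤ _ := Real.exp_le_exp.mpr (by nlinarith)
  rw [le_div_iff₀ hT0] at hPT2
  linarith

omit χ x in
/-- The length bookkeeping for `𝓛 ≥ 3`: `(⌈2T²⌉ − 1)·(⌈P₁⌉ − 1) ≤ ⌊P²⌋`,
`(⌈2T²⌉ − 1)·⌊PT⁻²⌋ ≤ ⌊P²⌋` and `log(⌊P²⌋ + 1) ≤ 3𝓛⁹`.
[cite: Zhang2022LandauSiegel, §2 (2.6), (2.21); §6 Lemma 6.1; §7 (7.2)] -/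
theorem product_lengths_of_three_le (hL : 3 ≤ ell D) :
    (⌈2 * bigT D ^ 2⌉₊ - 1) * (⌈Skeleton.P1 D⌉₊ - 1) ≤ ⌊bigP D ^ 2⌋₊ ∧
      (⌈2 * bigT D ^ 2⌉₊ - 1) * (⌊bigP D / bigT D ^ 2⌋₊ + 1 - 1) ≤ ⌊bigP D ^ 2⌋₊ ∧
      Real.log ((⌊bigP D ^ 2⌋₊ + 1 : ℕ) : ℝ) ≤ 3 * ell D ^ 9 := by
  obtain ⟨hP1P, hPTP, hPT1, hPP2⟩ := sizes_of_three_le hL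
  have hL0 : 0 < ell D := by linarith
  have hP : 0 < bigP D := Real.exp_pos _
  have hT0 : 0 < bigT D := Real.exp_pos _
  have hT2 : 0 < bigT D ^ 2 := pow_pos hT0 2
  have hP10 : 0 ≤ Skeleton.P1 D := Real.rpow_nonneg hP.le _
  -- real bounds for the truncated lengths
  have hA : ((⌈2 * bigT D ^ 2⌉₊ - 1 : ℕ) : ℝ) ≤ 2 * bigT D ^ 2 := by
    have h := (Nat.ceil_lt_add_one (show 0 ≤ 2 * bigT D ^ 2 by positivity)).le
    have hc : 1 ≤ ⌈2 * bigT D ^ 2⌉₊ := Nat.one_le_iff_ne_zero.mpr (Nat.ceil_pos.mpr (by positivity)).ne'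
    rw [Nat.cast_sub hc]; push_cast; linarith
  have hB : ((⌈Skeleton.P1 D⌉₊ - 1 : ℕ) : ℝ) ≤ Skeleton.P1 D := by
    have h := (Nat.ceil_lt_add_one hP10).le
    have hc : 1 ≤ ⌈Skeleton.P1 D⌉₊ := by
      have : 2 ≤ ⌈Skeleton.P1 D⌉₊ := (truncations_of_three_le hL).1.1
      omega
    rw [Nat.cast_sub hc]; push_cast; linarith
  have hC : ((⌊bigP D / bigT D ^ 2⌋₊ + 1 - 1 : ℕ) : ℝ) ≤ bigP D / bigT D ^ 2 := by
    rw [Nat.add_sub_cancel]; exact Nat.floor_le (by positivity)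
  -- `2T²·P₁ ≤ P²` and `2T²·(P/T²) = 2P ≤ P²`
  have hP1_le : Skeleton.P1 D ≤ bigP D := by linarith
  have h2T2 : 2 * bigT D ^ 2 ≤ bigP D := two_mul_bigT_sq_le_bigP hL
  have key1 : ((⌈2 * bigT D ^ 2⌉₊ - 1 : ℕ) : ℝ) * ((⌈Skeleton.P1 D⌉₊ - 1 : ℕ) : ℝ) ≤ bigP D ^ 2 := by
    calc _ ≤ (2 * bigT D ^ 2) * Skeleton.P1 D := mul_le_mul hA hB (Nat.cast_nonneg _) (by positivity)
      _ ≤ bigP D * bigP D := mul_le_mul h2T2 hP1_le hP10 hP.le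
      _ = bigP D ^ 2 := (sq _).symm
  have key2 : ((⌈2 * bigT D ^ 2⌉₊ - 1 : ℕ) : ℝ) * ((⌊bigP D / bigT D ^ 2⌋₊ + 1 - 1 : ℕ) : ℝ) ≤
      bigP D ^ 2 := by
    calc _ ≤ (2 * bigT D ^ 2) * (bigP D / bigT D ^ 2) :=
          mul_le_mul hA hC (Nat.cast_nonneg _) (by positivity)
      _ = 2 * bigP D := by field_simp
      _ ≤ bigP D * bigP D := by nlinarith
      _ = bigP D ^ 2 := (sq _).symm
  refine ⟨?_, ?_, ?_⟩
  · exact Nat.le_floor (by exact_mod_cast key1)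
  · exact Nat.le_floor (by exact_mod_cast key2)
  · have hP2 : bigP D ^ 2 = Real.exp (2 * ell D ^ 9) := by rw [bigP, ← Real.exp_nat_mul]; ring_nf
    have hfl : ((⌊bigP D ^ 2⌋₊ + 1 : ℕ) : ℝ) ≤ Real.exp (3 * ell D ^ 9) := by
      push_cast
      have h1 : (⌊bigP D ^ 2⌋₊ : ℝ) ≤ bigP D ^ 2 := Nat.floor_le (by positivity)
      have h27 : (3 : ℝ) ^ 9 ≤ ell D ^ 9 := pow_le_pow_left₀ (by norm_num) hL 9
      have hgap : Real.exp (2 * ell D ^ 9) + 1 ≤ Real.exp (3 * ell D ^ 9) := by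
        have e : Real.exp (3 * ell D ^ 9) = Real.exp (2 * ell D ^ 9) * Real.exp (ell D ^ 9) := by
          rw [← Real.exp_add]; ring_nf
        have h2 : (2 : ℝ) ≤ Real.exp (ell D ^ 9) := by
          calc (2 : ℝ) ≤ ell D ^ 9 + 1 := by nlinarith
            _ ≤ Real.exp (ell D ^ 9) := Real.add_one_le_exp _
        have h3 : (1 : ℝ) ≤ Real.exp (2 * ell D ^ 9) := Real.one_le_exp (by positivity)
        rw [e]; nlinarith
      have h1' : (⌊bigP D ^ 2⌋₊ : ℝ) ≤ Real.exp (2 * ell D ^ 9) := hP2 ▸ h1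
      linarith
    calc Real.log ((⌊bigP D ^ 2⌋₊ + 1 : ℕ) : ℝ) ≤ Real.log (Real.exp (3 * ell D ^ 9)) :=
          Real.log_le_log (by positivity) hfl
      _ = 3 * ell D ^ 9 := Real.log_exp _

/-- **I3-N for `B₁`**: for `𝓛 ≥ 3`, `Re β = 0`, `|σ − ½| ≤ 2α` and any finite `T ⊆ Ψ`,
`Σ_{ψ∈T} |N(s+β,ψ)·(H₁₄ + ι₂H₁₂)(s,ψ)|² ≤ C₃₃·e^{8π}·majorantConst(4,4)·(1+|ι₂|)²·3⁴·P²·𝓛³⁶`.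
[cite: Zhang2022LandauSiegel, §13 (13.3), (13.11) p.75; Lemma 6.1; Lemma 3.3 p.14] -/
theorem meanSq_Nchar_mul_B1_le (hL : 3 ≤ ell D) (T : Finset (Chr D)) {s β : ℂ}
    (hs : |s.re - 1 / 2| ≤ 2 * alpha D) (hβ : β.re = 0) :
    ∑ x ∈ T, ‖Nchar D (psiFn x) (s + β) * (H14 χ x s + iota2 * H12 χ x s)‖ ^ 2 ≤
      (2 + 2 * (3 + (Real.log 2 ^ 68)⁻¹) ^ 2) * Real.exp (8 * π) * majorantConst 4 4 *
        (1 + ‖iota2‖) ^ 2 * 3 ^ 4 * bigP D ^ 2 * ell D ^ 36 := by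
  have hL1 : 1 ≤ ell D := by linarith
  have hL0 : 0 < ell D := by linarith
  have hD2 : 2 ≤ Real.log D := by have h := hL; rw [ell] at h; linarith
  obtain ⟨hLM, -, hlog⟩ := product_lengths_of_three_le hL
  have hF := norm_Nchar_coeff_le (D := D) hL0 hβ
  have hG : ∀ n : ℕ, n ≠ 0 →
      ‖((if (n : ℝ) < bigP D ^ (1 / 2 : ℝ) then vk1 D n else 0) + iota2 * vk2 D n) * χ (n : ZMod D)‖ ≤
        (1 + ‖iota2‖) * tau 1 n := fun n hn => by
    rw [tau_one_apply hn, mul_one, norm_mul]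
    exact (mul_le_of_le_one_right (norm_nonneg _) (DirichletCharacter.norm_le_one χ _)).trans
      (norm_coefB1_le hD2 n)
  have h := meanSq_mul_le_of_le_tau hL1 T hs zero_le_one hF hG hLM
  -- rewrite the two factors
  have hB1 : ∀ x : Chr D, H14 χ x s + iota2 * H12 χ x s = ∑ n ∈ Finset.Ico 1 ⌈Skeleton.P1 D⌉₊,
      (((if (n : ℝ) < bigP D ^ (1 / 2 : ℝ) then vk1 D n else 0) + iota2 * vk2 D n) * χ (n : ZMod D)) *
        x.ψ (n : ZMod x.p) * (n : ℂ) ^ (-s) := by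
    intro x
    rw [B1_eq_sum χ x s]
    refine Finset.sum_congr rfl fun n _ => ?_
    rw [pc]; ring
  simp_rw [hB1, Nchar_shift_eq_sum]
  refine h.trans ?_
  have hlog0 : 0 ≤ Real.log ((⌊bigP D ^ 2⌋₊ + 1 : ℕ) : ℝ) := Real.log_natCast_nonneg _
  have hpow : Real.log ((⌊bigP D ^ 2⌋₊ + 1 : ℕ) : ℝ) ^ ((1 + 1) ^ 2) ≤ (3 * ell D ^ 9) ^ ((1 + 1) ^ 2) :=
    pow_le_pow_left₀ hlog0 hlog _
  have hK : 0 ≤ (2 + 2 * (3 + (Real.log 2 ^ 68)⁻¹) ^ 2) * Real.exp (8 * π) *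
      majorantConst ((1 + 1) ^ 2) (2 * (1 + 1)) * (1 * (1 + ‖iota2‖)) ^ 2 * bigP D ^ 2 :=
    mul_nonneg (mul_nonneg (mul_nonneg (mul_nonneg c33_nonneg (Real.exp_nonneg _))
      (majorantConst_pos _ _).le) (sq_nonneg _)) (sq_nonneg _)
  refine (mul_le_mul_of_nonneg_left hpow hK).trans (le_of_eq ?_)
  norm_num
  ring

/-- **I3-N for `B₂ = H₂`**: for `𝓛 ≥ 3`, `Re β = 0`, `|σ − ½| ≤ 2α` and any finite `T ⊆ Ψ`,
`Σ_{ψ∈T} |N(s+β,ψ)·H₂(s,ψ)|² ≤ C₃₃·e^{8π}·majorantConst(4,4)·(|ι₃|+|ι₄|)²·3⁴·P²·𝓛³⁶`.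
[cite: Zhang2022LandauSiegel, §13 (13.3), (13.11) p.75; Lemma 6.1; Lemma 3.3 p.14] -/
theorem meanSq_Nchar_mul_H2_le (hL : 3 ≤ ell D) (T : Finset (Chr D)) {s β : ℂ}
    (hs : |s.re - 1 / 2| ≤ 2 * alpha D) (hβ : β.re = 0) :
    ∑ x ∈ T, ‖Nchar D (psiFn x) (s + β) * H2 χ x s‖ ^ 2 ≤
      (2 + 2 * (3 + (Real.log 2 ^ 68)⁻¹) ^ 2) * Real.exp (8 * π) * majorantConst 4 4 *
        (‖iota3‖ + ‖iota4‖) ^ 2 * 3 ^ 4 * bigP D ^ 2 * ell D ^ 36 := by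
  have hL1 : 1 ≤ ell D := by linarith
  have hL0 : 0 < ell D := by linarith
  have hD2 : 2 ≤ Real.log D := by have h := hL; rw [ell] at h; linarith
  obtain ⟨hLM, -, hlog⟩ := product_lengths_of_three_le hL
  have hF := norm_Nchar_coeff_le (D := D) hL0 hβ
  have hG : ∀ n : ℕ, n ≠ 0 →
      ‖(conj iota3 * vk3 D n + conj iota4 * vk2 D n) * χ (n : ZMod D)‖ ≤
        (‖iota3‖ + ‖iota4‖) * tau 1 n := fun n hn => by
    rw [tau_one_apply hn, mul_one, norm_mul]
    exact (mul_le_of_le_one_right (norm_nonneg _) (DirichletCharacter.norm_le_one χ _)).trans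
      (norm_coefH2_le hD2 n)
  have h := meanSq_mul_le_of_le_tau hL1 T hs zero_le_one hF hG hLM
  have hH2 : ∀ x : Chr D, H2 χ x s = ∑ n ∈ Finset.Ico 1 ⌈Skeleton.P1 D⌉₊,
      ((conj iota3 * vk3 D n + conj iota4 * vk2 D n) * χ (n : ZMod D)) *
        x.ψ (n : ZMod x.p) * (n : ℂ) ^ (-s) := by
    intro x
    rw [H2_eq_sum χ x s]
    refine Finset.sum_congr rfl fun n _ => ?_
    rw [pc]; ring
  simp_rw [hH2, Nchar_shift_eq_sum]
  refine h.trans ?_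
  have hlog0 : 0 ≤ Real.log ((⌊bigP D ^ 2⌋₊ + 1 : ℕ) : ℝ) := Real.log_natCast_nonneg _
  have hpow : Real.log ((⌊bigP D ^ 2⌋₊ + 1 : ℕ) : ℝ) ^ ((1 + 1) ^ 2) ≤ (3 * ell D ^ 9) ^ ((1 + 1) ^ 2) :=
    pow_le_pow_left₀ hlog0 hlog _
  have hK : 0 ≤ (2 + 2 * (3 + (Real.log 2 ^ 68)⁻¹) ^ 2) * Real.exp (8 * π) *
      majorantConst ((1 + 1) ^ 2) (2 * (1 + 1)) * (1 * (‖iota3‖ + ‖iota4‖)) ^ 2 * bigP D ^ 2 :=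
    mul_nonneg (mul_nonneg (mul_nonneg (mul_nonneg c33_nonneg (Real.exp_nonneg _))
      (majorantConst_pos _ _).le) (sq_nonneg _)) (sq_nonneg _)
  refine (mul_le_mul_of_nonneg_left hpow hK).trans (le_of_eq ?_)
  norm_num
  ring

/-- **I3-N for `B = (H₁₄ + ι₂H₁₂)H₂`**: for `𝓛 ≥ 3`, `Re β = 0`, `|σ − ½| ≤ 2α` and any finite `T ⊆ Ψ`,
`Σ_{ψ∈T} |N(s+β,ψ)·B(s,ψ)|² ≤ C₃₃·e^{8π}·majorantConst(9,6)·((1+|ι₂|)(|ι₃|+|ι₄|))²·3⁹·P²·𝓛⁸¹`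
(`b ≪ τ₂` (15.2), so the product coefficient is `≪ τ₃`; `Σ τ₃²/k ≪ (log)⁹`).
[cite: Zhang2022LandauSiegel, §13 (13.3), (13.11) p.75; Lemma 6.1; §15 (15.2); Lemma 3.3 p.14] -/
theorem meanSq_Nchar_mul_Bpoly_le (hL : 3 ≤ ell D) (T : Finset (Chr D)) {s β : ℂ}
    (hs : |s.re - 1 / 2| ≤ 2 * alpha D) (hβ : β.re = 0) :
    ∑ x ∈ T, ‖Nchar D (psiFn x) (s + β) * Bpoly χ x s‖ ^ 2 ≤
      (2 + 2 * (3 + (Real.log 2 ^ 68)⁻¹) ^ 2) * Real.exp (8 * π) * majorantConst 9 6 *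
        ((1 + ‖iota2‖) * (‖iota3‖ + ‖iota4‖)) ^ 2 * 3 ^ 9 * bigP D ^ 2 * ell D ^ 81 := by
  have hL1 : 1 ≤ ell D := by linarith
  have hL0 : 0 < ell D := by linarith
  have hD2 : 2 ≤ Real.log D := by have h := hL; rw [ell] at h; linarith
  obtain ⟨-, hLM, hlog⟩ := product_lengths_of_three_le hL
  have hF := norm_Nchar_coeff_le (D := D) hL0 hβ
  have hG : ∀ n : ℕ, n ≠ 0 → ‖bcoef D n * χ (n : ZMod D)‖ ≤
      ((1 + ‖iota2‖) * (‖iota3‖ + ‖iota4‖)) * tau 2 n := fun n _ => by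
    rw [norm_mul]
    exact (mul_le_of_le_one_right (norm_nonneg _) (DirichletCharacter.norm_le_one χ _)).trans
      (norm_bcoef_le hD2 n)
  have h := meanSq_mul_le_of_le_tau hL1 T hs zero_le_one hF hG hLM
  have hB : ∀ x : Chr D, Bpoly χ x s = ∑ n ∈ Finset.Ico 1 (⌊bigP D / bigT D ^ 2⌋₊ + 1),
      (bcoef D n * χ (n : ZMod D)) * x.ψ (n : ZMod x.p) * (n : ℂ) ^ (-s) := by
    intro x
    rw [Bpoly_eq_sum_Ico χ x hL s]
    refine Finset.sum_congr rfl fun n _ => ?_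
    rw [pc]; ring
  simp_rw [hB, Nchar_shift_eq_sum]
  refine h.trans ?_
  have hlog0 : 0 ≤ Real.log ((⌊bigP D ^ 2⌋₊ + 1 : ℕ) : ℝ) := Real.log_natCast_nonneg _
  have hpow : Real.log ((⌊bigP D ^ 2⌋₊ + 1 : ℕ) : ℝ) ^ ((1 + 2) ^ 2) ≤ (3 * ell D ^ 9) ^ ((1 + 2) ^ 2) :=
    pow_le_pow_left₀ hlog0 hlog _
  have hK : 0 ≤ (2 + 2 * (3 + (Real.log 2 ^ 68)⁻¹) ^ 2) * Real.exp (8 * π) *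
      majorantConst ((1 + 2) ^ 2) (2 * (1 + 2)) * (1 * ((1 + ‖iota2‖) * (‖iota3‖ + ‖iota4‖))) ^ 2 *
        bigP D ^ 2 :=
    mul_nonneg (mul_nonneg (mul_nonneg (mul_nonneg c33_nonneg (Real.exp_nonneg _))
      (majorantConst_pos _ _).le) (sq_nonneg _)) (sq_nonneg _)
  refine (mul_le_mul_of_nonneg_left hpow hK).trans (le_of_eq ?_)
  norm_num
  ring

end Instances

end Literature.NumberTheory.LFunctions.Zhang2022.Typed.Section13
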